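import Mathlib
import HarnessLib
import Summits.KontsevichZagierPeriods.KontsevichZagierPeriods.Theses.FurushoPentagon
import Summits.KontsevichZagierPeriods.KontsevichZagierPeriods.Theorems.FurushoPentagonDoubleShuffleOfPentagon
import Summits.KontsevichZagierPeriods.KontsevichZagierPeriods.Theorems.PentagonInKZ.Negative.RulesAssociator
import Literature.NumberTheory.Transcendental.KZRulesAssociator

/-!
# `KernelModuloPeriodConjecture`, line `Sketch`: formal Hoffman spanning in `P_ℚ` (stub G1)

Stub `stub_formalHoffmanSpan` of the crux `FurushoPentagon.KernelModuloPeriodConjecture`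
(stmt-KontsevichZagierPeriods-15058). Write `P := KZ.FormalRep ⧸ KZ.relations`
(`KZ.FormalPeriodRing`), `P_ℚ := ℚ ⊗ P` (`KZ.FormalPeriodAlgebra`) and `Φ_P ∈ P_ℚ⟨⟨X₀, X₁⟩⟩` for
the rules associator (`KZ.rulesAssociator`: `c_W(Φ_P) = (−1)^{dp W} Z(W)`, the shuffle-regularised
class of the simplex representations). The statement: under `PentagonInKZ` and `ReducedPeriodRing`,
the ALGEBRAIC LEAF of the line — "for every admissible `s` one rational combination `b` of Hoffman
indices with `c_{binaryWord s}(φ) = Σ_t b_t c_{binaryWord t}(φ)` at every group-like pentagon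
solution `φ` over every reduced commutative `ℚ`-algebra" — gives, for every admissible `s`,
`1 ⊗ ⟦ζ(s)⟧ ∈ span_ℚ {1 ⊗ ⟦ζ(t)⟧ : t ∈ {2,3}^×}` in `P_ℚ`.

Proof: `Φ_P` is group-like (`isGroupLike_rulesAssociator`: the universal realisation
`χ₀ : FormalRep → P_ℚ` is a realisation of the rules, its series is `Φ_P`
(`PentagonInKZNegative.cruxSeries_chiUniv`), and the series of every realisation is group-like by
the proved `ShuffleIsDissection` — `DoubleShuffleOfPentagon.isGroupLike_realisation`);
`PentagonInKZ` is Drinfeld's pentagon for `Φ_P` (`PentagonInKZNegative.pentagonInKZ_iff_rulesAssociator`);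
`P_ℚ` is reduced (`DoubleShuffleOfPentagon.isReduced_formalPeriodAlgebra`). Reading the leaf at
`(P_ℚ, Φ_P)` and `c_{binaryWord u}(Φ_P) = (−1)^{depth u} (1 ⊗ ⟦ζ(u)⟧)`
(`KZ.rulesAssociator_binaryWord`) gives the span statement.

References: H. Furusho, Ann. of Math. 174 (2011), §2 [Furusho2011]; H. Furusho, Publ. RIMS 39
(2003), Prop. 3.2.3 [Furusho2003]; M. Kontsevich, D. Zagier, *Periods* (2001), §4.1
[KontsevichZagier2001]; F. Brown, Ann. of Math. 175 (2012), Thm 1.1 [Brown2012].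
-/

noncomputable section

namespace Summit.KontsevichZagierPeriods.FurushoPentagon.KernelModuloPeriodConjecture

open Literature.NumberTheory.Transcendental
open Literature.NumberTheory.Transcendental.KZ
open Summit.KontsevichZagierPeriods.KontsevichZagierPeriods.Theses.FurushoPentagon
open Summit.KontsevichZagierPeriods.FurushoPentagon.PentagonInKZNegative
  (chiUniv isRealisation_chiUniv simplexZ simplexZ_agrees cruxSeries cruxSeries_chiUniv
    pentagonInKZ_iff_rulesAssociator)
open Summit.KontsevichZagierPeriods.FurushoPentagon.DoubleShuffleOfPentagon
  (isGroupLike_realisation isReduced_formalPeriodAlgebra)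

/-- **The rules associator `Φ_P` is group-like** (unconditionally): the universal realisation
`χ₀ : FormalRep → P_ℚ` kills the relations, is multiplicative and non-degenerate, so its
shuffle-regularised series — which is `Φ_P` (`cruxSeries_chiUniv`) — is group-like by the proved
item `ShuffleIsDissection` (`isGroupLike_realisation`). [cite: IharaKanekoZagier2006, Thm 1] -/
theorem isGroupLike_rulesAssociator : NCSeries.IsGroupLike KZ.rulesAssociator := by
  have h := isGroupLike_realisation KZ.FormalPeriodAlgebra chiUniv isRealisation_chiUniv.rel
    isRealisation_chiUniv.mul isRealisation_chiUniv.unit simplexZ simplexZ_agrees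
  have h' : NCSeries.IsGroupLike (cruxSeries KZ.FormalPeriodAlgebra chiUniv simplexZ) := h
  rwa [cruxSeries_chiUniv] at h'

/-- `(−1)^k · y = ((−1)^k : ℚ) • y` in the `ℚ`-algebra `P_ℚ`. [folklore] -/
theorem formalSpan_neg_one_pow_mul (k : ℕ) (y : KZ.FormalPeriodAlgebra) :
    (-1 : KZ.FormalPeriodAlgebra) ^ k * y = ((-1 : ℚ) ^ k) • y := by
  rw [Algebra.smul_def, map_pow, map_neg, map_one]

/-- **G1 — formal Hoffman spanning in `P_ℚ`** (registered stub `stub_formalHoffmanSpan` of the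
line `Sketch` on crux stmt-KontsevichZagierPeriods-15058). Under `PentagonInKZ` and
`ReducedPeriodRing`, the algebraic leaf read at the group-like pentagon point `Φ_P` over the
reduced `ℚ`-algebra `P_ℚ` gives: for every admissible `s`,
`1 ⊗ ⟦ζ(s)⟧ ∈ span_ℚ {1 ⊗ ⟦ζ(t)⟧ : t Hoffman}`. [cite: Furusho2011, §2] -/
theorem stub_formalHoffmanSpan :
    PentagonInKZ → ReducedPeriodRing → (∀ s : List ℕ, MZV.IsAdmissible s → ∃ b : List ℕ →₀ ℚ, (∀ t ∈ b.support, MZV.IsHoffman t ∧ MZV.weight t = MZV.weight s) ∧ ∀ (R : Type) [CommRing R] [Algebra ℚ R] [IsReduced R] (φ : NCSeries Bool R), NCSeries.IsGroupLike φ → NCSeries.DrinfeldPentagon φ → φ (MZV.binaryWord s) = b.sum (fun t q => q • φ (MZV.binaryWord t))) → ∀ s : List ℕ, MZV.IsAdmissible s → KZ.toPeriodAlgebra (KZ.mzvClass s) ∈ Submodule.span ℚ (Set.range (fun t : {t : List ℕ // MZV.IsHoffman t} => KZ.toPeriodAlgebra (KZ.mzvClass t.1))) := by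
  intro hP hR hA s hs
  haveI : IsReduced KZ.FormalPeriodAlgebra := isReduced_formalPeriodAlgebra hR
  have hPent : NCSeries.DrinfeldPentagon KZ.rulesAssociator := pentagonInKZ_iff_rulesAssociator.mp hP
  obtain ⟨b, hb, hall⟩ := hA s hs
  have key := hall KZ.FormalPeriodAlgebra KZ.rulesAssociator isGroupLike_rulesAssociator hPent
  rw [KZ.rulesAssociator_binaryWord hs] at key
  -- `1 ⊗ ⟦ζ(s)⟧ = (−1)^{depth s} · Σ_t b_t • c_{binaryWord t}(Φ_P)`
  have hx : KZ.toPeriodAlgebra (KZ.mzvClass s) =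
      (-1 : KZ.FormalPeriodAlgebra) ^ MZV.depth s *
        b.sum (fun t q => q • KZ.rulesAssociator (MZV.binaryWord t)) := by
    rw [← key, ← mul_assoc, ← pow_add, ← two_mul, pow_mul, neg_one_sq, one_pow, one_mul]
  rw [hx, formalSpan_neg_one_pow_mul]
  refine Submodule.smul_mem _ _ ?_
  rw [Finsupp.sum]
  refine Submodule.sum_mem _ fun t ht => ?_
  have hH : MZV.IsHoffman t := (hb t ht).1
  rw [KZ.rulesAssociator_binaryWord hH.isAdmissible, formalSpan_neg_one_pow_mul]
  refine Submodule.smul_mem _ _ (Submodule.smul_mem _ _ (Submodule.subset_span ?_))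
  exact ⟨⟨t, hH⟩, rfl⟩

end Summit.KontsevichZagierPeriods.FurushoPentagon.KernelModuloPeriodConjecture

end
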